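/-
Copyright (c) 2026. All rights reserved.
Released under Apache 2.0 license as described in the file LICENSE.
-/
import Literature.NumberTheory.ComplexMultiplication.CMTypeRankReflexDegreeComplex
import Literature.AlgebraicGeometry.Pohlmann1968.NonSimpleCMAbelianVarietyHazamaCriterion
import Literature.AlgebraicGeometry.Pohlmann1968.NondegenerateCMTypeDivisorGenerated
import Literature.AlgebraicGeometry.ComplexMultiplication.SimpleIffPrimitiveCMType
import HarnessLib

/-!
# Rank `2`, the MINIMAL Kubota rank: the abelian varieties of a rank-`2` CM type (isogenous to a power of a CM elliptic
# curve) are never simple in degree `> 2`, and `Bᵐ(Aⁿ) ⊗ ℂ = Dᵐ(Aⁿ) ⊗ ℂ` and the Hodge conjecture hold for every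
# power of every one of them, over ANY CM field

The tree's `CMTypeRankReflexDegreeComplex` (seat p11) proves, for every CM type `Φ` of every CM field `K`:
`2 ≤ Rank(Φ)` (`two_le_cmTypeRank_complex`; K. A. Ribet [Ribet1980] §3 (3.5) on the primitive core), `Rank(Φ) = 2
⟺ [ℚ(tr_Φ) : ℚ] = 2 ⟺ Φ = Ψ^K` is induced from a CM type `Ψ` of an imaginary quadratic subfield `k ⊆ K`
(`cmTypeRank_eq_two_iff_exists_inducedCMType_quadratic`; G. Shimura [Shimura1998] §8.4 Example (2)(A), M. Streng
[Streng2010] Ch. I Lemma 3.4 (1) / 3.5), and `three_le_cmTypeRank_of_isPrimitive` (`[K:ℚ] ≥ 4`).  THIS FILE draws the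
consequences on the abelian varieties `(A, ι, θ)` of type `(K; Φ)` read on `H¹`:

* §1 `not_isPrimitive_of_cmTypeRank_eq_two`, **`not_isSimple_of_cmTypeRank_eq_two`** (`[K:ℚ] > 2`: a rank-`2` type
  is imprimitive and its varieties are not simple — Shimura §8.2 Prop. 26, tree `isSimple_iff_isPrimitive`),
  `three_le_cmTypeRank_of_isSimple` (`A` simple, `[K:ℚ] > 2` ⟹ `Rank(Φ) ≥ 3`).
* §2 **`hodgeClassSpan_pow_eq_divisorClassesSpan_of_cmTypeRank_eq_two`** — `Rank(Φ) = 2` ⟹ for EVERY realisation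
  and all `n, m`: `Bᵐ(Aⁿ) ⊗ ℂ = Dᵐ(Aⁿ) ⊗ ℂ` (the quadratic core `(k, Ψ)` is nondegenerate, T. Kubota [Kubota1965] §2,
  and Pohlmann–Hazama transfers along `Φ = Ψ^K`, tree `IsNondegenerate.hodgeClassSpan_pow_eq_divisorClassesSpan_inducedCMType`;
  B. B. Gordon [Gordon1999HodgeAVSurvey] Thm. 6.4, §9.3); **`hodgeConjectureFor_pow_of_cmTypeRank_eq_two`** — THE
  HODGE CONJECTURE FOR EVERY POWER OF EVERY ABELIAN VARIETY WHOSE CM TYPE HAS THE MINIMAL RANK `2`, over ANY CM field;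
  `hodgeClasses_algebraic_pow_of_cmTypeRank_eq_two`, `not_exists_exceptional_pow_of_cmTypeRank_eq_two`.

HONEST SCOPE.  Assembly of tree theorems; the varieties concerned are those isogenous to a power of a CM elliptic curve
(through a CM type), for which the divisor-generation of the Hodge ring of all powers is classical.  THEOREMS ONLY: no
definition, no named fact, no instance, no `sorry`.

## References

* [Ribet1980] K. A. Ribet, §3 (3.5) and Examples (3.7) (p. 87).
* [Shimura1998] G. Shimura, §8.2 Prop. 26, §8.4 Example (2)(A).
* [Streng2010] M. Streng, Ch. I Lemma 3.4 (1), Lemma 3.5.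
* [Gordon1999HodgeAVSurvey] B. B. Gordon, Thm. 6.4, §9.3.
* [Kubota1965] T. Kubota, §2 (p. 115).

## Provenance

Lane `lit-hodgefound` (Track 2, Layer A5), seat `lit-hodgefound-p10` generation 37, row g37-#9; neighbours cited by
name, nothing restated: `CMTypeRankReflexDegreeComplex` (`cmTypeRank_eq_two_iff_exists_inducedCMType_quadratic`,
`three_le_cmTypeRank_of_isPrimitive`, `two_le_cmTypeRank_complex`), `CMTypeInducedFromPrimitive`
(`isCMField_of_cmType_intermediateField`), `SimpleIffPrimitiveCMType` (`isSimple_iff_isPrimitive`),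
`NondegenerateCMTypeDivisorGenerated` (`isNondegenerate_of_finrank_eq_two`), `NonSimpleCMAbelianVarietyHazamaCriterion`
(`IsNondegenerate.hodgeClassSpan_pow_eq_divisorClassesSpan_inducedCMType`), `CMTypeQuadraticReflexField`
(`two_le_finrank_of_cmType`).
-/

open scoped Classical NumberField
open NumberField Module CategoryTheory CategoryTheory.Limits

namespace Literature.AlgebraicGeometry.Pohlmann1968

-- `open scoped`: the tree's action of `Aut(ℂ)` on `Hom(K, ℂ)` by composition is a scoped instance
open scoped Literature.NumberTheory.ComplexMultiplication
open Literature.NumberTheory.ComplexMultiplication (IsPrimitive inducedCMType isCMField_of_cmType_intermediateField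
  two_le_finrank_of_cmType cmTypeRank_eq_two_iff_exists_inducedCMType_quadratic three_le_cmTypeRank_of_isPrimitive)
open Literature.AlgebraicGeometry.Motives (CMType AbelianVariety)
open Literature.AlgebraicGeometry.HodgeTheory
open Literature.AlgebraicGeometry.VanGeemen1994 (hodgeClassSpan)
open Literature.Barriers.HodgeConjecture (divisorClassesSpan)
open Literature.AlgebraicGeometry.ComplexMultiplication (IsCMTypeRealisation isSimple_iff_isPrimitive)

variable {K : Type} [Field K] [NumberField K] [IsCMField K]
  {A : AbelianVariety ℂ} {ι : 𝓞 K →+* End A} {θ : K →+* Module.End ℂ (complexBetti A.X 1)}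

/-! ## §1 Rank `2` ⟹ imprimitive, not simple (`[K:ℚ] > 2`) -/

omit [IsCMField K] in
/-- `2 < [K:ℚ]` ⟹ `4 ≤ [K:ℚ]` for a field carrying a CM type (even degree). [cite: Shimura1998, §8.2] -/
private theorem four_le_finrank_of_two_lt (hK : 2 < finrank ℚ K) (Φ : CMType K) : 4 ≤ finrank ℚ K := by
  have h := Literature.AlgebraicGeometry.Motives.HodgeStructure.two_mul_ncard_cmType_eq_finrank Φ
  omega

/-- **Rank-`2` CM types of a CM field of degree `> 2` are NOT primitive** (a primitive type of a field of degree `≥ 4`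
has rank `≥ 3`, Ribet (3.5); tree `three_le_cmTypeRank_of_isPrimitive`). [cite: Ribet1980, §3 (3.5) and (3.7) (p. 87)]
[cite: Shimura1998, §8.2 Prop. 26] -/
theorem not_isPrimitive_of_cmTypeRank_eq_two (hK : 2 < finrank ℚ K) (Φ : CMType K) (φ₀ : K →+* ℂ)
    (hr : cmTypeRank Φ = 2) : ¬ IsPrimitive (ℂ ≃+* ℂ) Φ.1 φ₀ := fun hprim => by
  have h3 := three_le_cmTypeRank_of_isPrimitive (four_le_finrank_of_two_lt hK Φ) hprim
  omega

/-- **The abelian varieties of a rank-`2` CM type of a CM field of degree `> 2` are NOT simple** (they are isogenous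
to `E^{[K:ℚ]/2}`, `E` a CM elliptic curve; simple ⟺ primitive, Shimura). [cite: Shimura1998, §8.2 Prop. 26]
[cite: Ribet1980, §3 Examples (3.7) (p. 87)] -/
theorem not_isSimple_of_cmTypeRank_eq_two (hK : 2 < finrank ℚ K) (Φ : CMType K)
    (hA : IsCMTypeRealisation Φ A ι θ) (hr : cmTypeRank Φ = 2) : ¬ A.IsSimple := fun hs => by
  obtain ⟨φ₀⟩ : Nonempty (K →+* ℂ) := inferInstance
  exact not_isPrimitive_of_cmTypeRank_eq_two hK Φ φ₀ hr ((isSimple_iff_isPrimitive hA φ₀).1 hs)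

/-- **`A` simple and `[K:ℚ] > 2` ⟹ `Rank(Φ) ≥ 3`.** [cite: Ribet1980, §3 (3.5) (p. 87)] [cite: Shimura1998, §8.2 Prop. 26] -/
theorem three_le_cmTypeRank_of_isSimple (hK : 2 < finrank ℚ K) (Φ : CMType K)
    (hA : IsCMTypeRealisation Φ A ι θ) (hs : A.IsSimple) : 3 ≤ cmTypeRank Φ := by
  obtain ⟨φ₀⟩ : Nonempty (K →+* ℂ) := inferInstance
  exact three_le_cmTypeRank_of_isPrimitive (four_le_finrank_of_two_lt hK Φ) ((isSimple_iff_isPrimitive hA φ₀).1 hs)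

/-- **`A` simple ⟹ `Rank(Φ) = 2` iff `K` is imaginary quadratic** (`A` an elliptic curve with CM).
[cite: Ribet1980, §3 (3.5) and Examples (3.7) (p. 87)] [cite: Kubota1965, §2 (p. 115)] -/
theorem cmTypeRank_eq_two_iff_finrank_eq_two_of_isSimple (Φ : CMType K) (hA : IsCMTypeRealisation Φ A ι θ)
    (hs : A.IsSimple) : cmTypeRank Φ = 2 ↔ finrank ℚ K = 2 := by
  constructor
  · intro hr
    by_contra h2
    have hK : 2 < finrank ℚ K := lt_of_le_of_ne (two_le_finrank_of_cmType Φ) (Ne.symm h2)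
    exact not_isSimple_of_cmTypeRank_eq_two hK Φ hA hr hs
  · intro h2
    rw [(isNondegenerate_iff Φ).1 (isNondegenerate_of_finrank_eq_two Φ h2), h2]

/-! ## §2 Rank `2` ⟹ `Bᵐ(Aⁿ) ⊗ ℂ = Dᵐ(Aⁿ) ⊗ ℂ` and the Hodge conjecture for every power, over any CM field -/

/-- **`Rank(Φ) = 2` ⟹ `Bᵐ(Aⁿ) ⊗ ℂ = Dᵐ(Aⁿ) ⊗ ℂ` FOR ALL `n, m`**, for EVERY realisation `(A, ι, θ)` of `Φ` over ANY CM
field `K`: the quadratic core `(k, Ψ)` is nondegenerate and Pohlmann–Hazama transfers along `Φ = Ψ^K` (`A ≅ E^h` up to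
isogeny). [cite: Gordon1999HodgeAVSurvey, Thm. 6.4 and §9.3] [cite: Kubota1965, §2 (p. 115)] [cite: Streng2010, Ch. I Lemma 3.5] -/
theorem hodgeClassSpan_pow_eq_divisorClassesSpan_of_cmTypeRank_eq_two (Φ : CMType K) (hr : cmTypeRank Φ = 2)
    (hA : IsCMTypeRealisation Φ A ι θ) (n m : ℕ) :
    hodgeClassSpan (⨁ fun _ : Fin n => A).dim (⨁ fun _ : Fin n => A).X m =
      divisorClassesSpan (⨁ fun _ : Fin n => A).X (⨁ fun _ : Fin n => A).dim m := by
  obtain ⟨k, Ψ, hk, hΨ⟩ := (cmTypeRank_eq_two_iff_exists_inducedCMType_quadratic Φ).1 hr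
  haveI : IsCMField k := isCMField_of_cmType_intermediateField k Ψ
  exact (isNondegenerate_of_finrank_eq_two Ψ hk).hodgeClassSpan_pow_eq_divisorClassesSpan_inducedCMType hΨ hA n m

omit [IsCMField K] in
/-- `Bᵐ ⊗ ℂ = Dᵐ ⊗ ℂ` for all `m` on an abelian variety gives the Hodge conjecture for it (Lefschetz `(1,1)` and cup
products, tree theorems). [cite: Gordon1999HodgeAVSurvey, §9.3] -/
private theorem hodgeConjectureFor_of_forall_hodgeClassSpan_eq₂ (B : AbelianVariety ℂ)
    (h : ∀ m : ℕ, hodgeClassSpan B.dim B.X m = divisorClassesSpan B.X B.dim m) : HodgeConjectureFor B.dim B.X :=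
  ⟨nonempty_hodgeModel_holds (Motives.AbelianVariety.isSmoothProjective_holds (A := B)),
    fun m _ hc hmm => AbelianVariety.divisorClassesSpan_le_algebraicClasses B
      (fun b hb hb' => lefschetzOneOne_rational_holds (Motives.AbelianVariety.isSmoothProjective_holds (A := B)) b hb hb')
      m ((h m) ▸ Submodule.subset_span ⟨hc, hmm⟩)⟩

/-- **THE HODGE CONJECTURE FOR EVERY POWER OF EVERY ABELIAN VARIETY WHOSE CM TYPE HAS THE MINIMAL RANK `2`** — any CM
field `K`, any realisation `(A, ι, θ)` of a CM type `Φ` with `Rank(Φ) = 2` (the abelian varieties isogenous to a power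
of a CM elliptic curve, through a CM type): `HodgeConjectureFor` holds for `Aⁿ = ⨁_{i<n} A`, every `n`.
[cite: Gordon1999HodgeAVSurvey, Thm. 6.4 and §9.3] [cite: Ribet1980, §3 Examples (3.7) (p. 87)] -/
theorem hodgeConjectureFor_pow_of_cmTypeRank_eq_two (Φ : CMType K) (hr : cmTypeRank Φ = 2)
    (hA : IsCMTypeRealisation Φ A ι θ) (n : ℕ) :
    HodgeConjectureFor (⨁ fun _ : Fin n => A).dim (⨁ fun _ : Fin n => A).X :=
  hodgeConjectureFor_of_forall_hodgeClassSpan_eq₂ _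
    (fun m => hodgeClassSpan_pow_eq_divisorClassesSpan_of_cmTypeRank_eq_two Φ hr hA n m)

/-- **Every Hodge class on every power of an abelian variety of a rank-`2` CM type is algebraic.**
[cite: Gordon1999HodgeAVSurvey, Thm. 6.4 and §9.3] -/
theorem hodgeClasses_algebraic_pow_of_cmTypeRank_eq_two (Φ : CMType K) (hr : cmTypeRank Φ = 2)
    (hA : IsCMTypeRealisation Φ A ι θ) (n m : ℕ) (c : complexBetti (⨁ fun _ : Fin n => A).X (2 * m))
    (hcQ : IsRationalClass c) (hcH : IsOfHodgeType (⨁ fun _ : Fin n => A).dim (⨁ fun _ : Fin n => A).X (2 * m) m m c) :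
    c ∈ algebraicClasses (⨁ fun _ : Fin n => A).X m :=
  (hodgeConjectureFor_pow_of_cmTypeRank_eq_two Φ hr hA n).2 m c hcQ hcH

/-- **No power of an abelian variety of a rank-`2` CM type carries an exceptional Hodge class.**
[cite: Gordon1999HodgeAVSurvey, Thm. 6.4 and §9.3] -/
theorem not_exists_exceptional_pow_of_cmTypeRank_eq_two (Φ : CMType K) (hr : cmTypeRank Φ = 2)
    (hA : IsCMTypeRealisation Φ A ι θ) (n m : ℕ) :
    ¬ ∃ c : complexBetti (⨁ fun _ : Fin n => A).X (2 * m), IsRationalClass c ∧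
        IsOfHodgeType (⨁ fun _ : Fin n => A).dim (⨁ fun _ : Fin n => A).X (2 * m) m m c ∧
        c ∉ divisorClassesSpan (⨁ fun _ : Fin n => A).X (⨁ fun _ : Fin n => A).dim m := by
  rintro ⟨c, hcQ, hcH, hcD⟩
  exact hcD ((hodgeClassSpan_pow_eq_divisorClassesSpan_of_cmTypeRank_eq_two Φ hr hA n m) ▸
    Submodule.subset_span ⟨hcQ, hcH⟩)

end Literature.AlgebraicGeometry.Pohlmann1968
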